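import Summits.QuantumAdvantage.QuantumAdvantage.Theorems.SosSandwichQueryTopLevelStep
import HarnessLib

/-!
# `Q_T`: the TOP-LEVEL WEIGHT of a quantum acceptance probability is dominated by a top-level influence — Part 2

Support theorem for route `SosSandwich`, crux `PseudoBoundedAA` (stmt-QuantumAdvantage-15237); continuation of
`SosSandwichQueryTopLevelStep` (Part 1: `Δ_k = blockDiff`, `Γ = gam`, recursion and norm step).  This file runs
the INDUCTION along the algorithm and the PAIRING:

* `sum_norm_sq_gam_finalState_le` — for a `T`-query algorithm (`T ≥ 1`) and weights `c` on the `2T`-subsets with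
  `Σ_{U ∋ k} |c_U|² ≤ 1` for every index `k`: `Σ_{|R| = T} ‖Γ[ψ](R)‖² ≤ 1` for the final state `ψ` (invariant:
  level `≤ j`, `Σ_{|R| = 2T−j} Σ_{k ∈ R} ‖Δ_k Γ(R)‖² ≤ 1`, and `Σ_{|R| = 2T−j} ‖Γ(R)‖² ≤ 1` for `j ≥ 1`);
* `topCoeff A U = B(U) = Σ_{R ⊆ U, |R| = T} ⟨Π v_R, Π v_{U∖R}⟩` (the top-level bilinear coefficient; Part 3,
  file `SosSandwichQueryHomogeneousRung`, identifies it with the Walsh coefficient `p̂(U)` of the acceptance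
  probability for `|U| = 2T`);
* `pairing_eq`, `norm_pairing_le_one` — `Σ_{|R|=T} ⟨Π v_R, Γ(R)⟩ = Σ_{|U|=2T} c_U B(U)` has modulus `≤ 1`
  (Cauchy–Schwarz + Parseval `Σ_S ‖v_S‖² = 1`);
* **`exists_topWeight_sq_le`** — `∃ k, (Σ_{|U|=2T} |B(U)|²)² ≤ Σ_{|U|=2T, U ∋ k} |B(U)|²` (extremal weights
  `c_U = conj B(U)/√M`).

This is the coefficient-space form of Escudero Gutiérrez's creation-operator proof (no completely bounded norms are
needed: the contractions act on the Walsh coefficients of the running state).  All proved, standard axioms.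

Sources: EscuderoGutierrez2023 (arXiv:2304.06713) Thm 1.6 / Cor 1.7, §4.2; BealsEtAl2001 Lemma 4.1; ODonnell2014 §1.4.
-/

noncomputable section

set_option linter.dupNamespace false

namespace Summit.QuantumAdvantage.QuantumAdvantage.Theorems.SosSandwich.QueryTopLevel

open Matrix Finset Literature.Computability.Cryptography Literature.Computability.QuantumComplexity
open Literature.Computability.Complexity.LowDegree Literature.Probability.RandomGraphs.LowDegree
open Summit.QuantumAdvantage.QuantumAdvantage.Theorems.SosSandwich.QueryFourier

variable {N : ℕ} {W : Type*} [Fintype W]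

/-! ### The base of the induction: `Γ` of a constant state -/

omit [Fintype W] in
/-- At full size `|R| = T₂`, `Γ(R) = c_R · Ψ^(∅)`. [folklore] -/
theorem gam_top (c : Finset (Fin N) → ℂ) {T₂ : ℕ} (ψ : (Fin N → Bool) → Fin N × Bool × W → ℂ)
    {R : Finset (Fin N)} (hR : R.card = T₂) : gam c T₂ ψ R = c R • vfc ψ ∅ := by
  unfold gam
  have hfilter : Finset.univ.filter (fun U : Finset (Fin N) => U.card = T₂ ∧ R ⊆ U) = {R} := by
    ext U
    simp only [Finset.mem_filter, Finset.mem_univ, true_and, Finset.mem_singleton]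
    constructor
    · rintro ⟨hU, hRU⟩
      exact (Finset.eq_of_subset_of_card_le hRU (by rw [hU, hR])).symm
    · intro hUR
      rw [hUR]
      exact ⟨hR, Finset.Subset.refl R⟩
  rw [hfilter, Finset.sum_singleton, Finset.sdiff_self]

omit [Fintype W] in
/-- The empty Walsh coefficient of a constant state is the state itself. [cite: ODonnell2014, §1.2] -/
theorem vfc_const_empty (u : Fin N × Bool × W → ℂ) : vfc (fun _ : Fin N → Bool => u) ∅ = u := by
  funext s
  simp only [vfc, walsh_empty, Complex.ofReal_one, mul_one, Finset.sum_const, Finset.card_univ,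
    Fintype.card_fun, Fintype.card_bool, Fintype.card_fin, nsmul_eq_mul]
  push_cast
  field_simp

/-- `‖a • v‖² = ‖a‖² ‖v‖²` in sum-of-squares form. [folklore] -/
theorem sum_norm_sq_smul (a : ℂ) (v : Fin N × Bool × W → ℂ) :
    ∑ s, ‖(a • v) s‖ ^ 2 = ‖a‖ ^ 2 * ∑ s, ‖v s‖ ^ 2 := by
  rw [Finset.mul_sum]
  refine Finset.sum_congr rfl fun s _ => ?_
  rw [Pi.smul_apply, smul_eq_mul, norm_mul, mul_pow]

/-- Exchange `Σ_{|U| = T₂} Σ_{k ∈ U} = Σ_k Σ_{|U| = T₂, U ∋ k}`. [folklore] -/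
theorem sum_card_sum_mem {M : Type*} [AddCommMonoid M] (T₂ : ℕ) (g : Fin N → Finset (Fin N) → M) :
    ∑ U ∈ Finset.univ.filter (fun U : Finset (Fin N) => U.card = T₂), ∑ k ∈ U, g k U =
      ∑ k, ∑ U ∈ Finset.univ.filter (fun U : Finset (Fin N) => U.card = T₂ ∧ k ∈ U), g k U := by
  rw [Finset.sum_comm' (t' := Finset.univ)
    (s' := fun k => Finset.univ.filter (fun U : Finset (Fin N) => U.card = T₂ ∧ k ∈ U))]
  intro U k
  simp only [Finset.mem_filter, Finset.mem_univ, true_and]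
  tauto

/-- **Base case**: for a constant unit state `u` and weights with `Σ_{U ∋ k} |c_U|² ≤ 1` for all `k`,
`Σ_{|U| = T₂} Σ_{k ∈ U} ‖Δ_k Γ(U)‖² ≤ 1`. [cite: EscuderoGutierrez2023, proof of Thm 1.6] -/
theorem base_bound (c : Finset (Fin N) → ℂ) {T₂ : ℕ}
    (hc : ∀ k : Fin N, ∑ U ∈ Finset.univ.filter (fun U : Finset (Fin N) => U.card = T₂ ∧ k ∈ U), ‖c U‖ ^ 2 ≤ 1)
    (u : Fin N × Bool × W → ℂ) (hu : ∑ s, ‖u s‖ ^ 2 = 1) :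
    ∑ U ∈ Finset.univ.filter (fun U : Finset (Fin N) => U.card = T₂),
        ∑ k ∈ U, ∑ s, ‖blockDiff k (gam c T₂ (fun _ : Fin N → Bool => u) U) s‖ ^ 2 ≤ 1 := by
  have e : ∀ U ∈ Finset.univ.filter (fun U : Finset (Fin N) => U.card = T₂), ∀ k ∈ U,
      ∑ s, ‖blockDiff k (gam c T₂ (fun _ : Fin N → Bool => u) U) s‖ ^ 2 =
        ‖c U‖ ^ 2 * ∑ s, ‖blockDiff k u s‖ ^ 2 := by
    intro U hU k _
    rw [Finset.mem_filter] at hU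
    rw [gam_top c _ hU.2, vfc_const_empty, blockDiff_smul, sum_norm_sq_smul]
  rw [Finset.sum_congr rfl fun U hU => Finset.sum_congr rfl fun k hk => e U hU k hk, sum_card_sum_mem]
  calc ∑ k : Fin N, ∑ U ∈ Finset.univ.filter (fun U : Finset (Fin N) => U.card = T₂ ∧ k ∈ U),
          ‖c U‖ ^ 2 * ∑ s, ‖blockDiff k u s‖ ^ 2
      = ∑ k : Fin N, (∑ U ∈ Finset.univ.filter (fun U : Finset (Fin N) => U.card = T₂ ∧ k ∈ U), ‖c U‖ ^ 2) *
          ∑ s, ‖blockDiff k u s‖ ^ 2 := by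
        refine Finset.sum_congr rfl fun k _ => ?_
        rw [Finset.sum_mul]
    _ ≤ ∑ k : Fin N, 1 * ∑ s, ‖blockDiff k u s‖ ^ 2 :=
        Finset.sum_le_sum fun k _ => mul_le_mul_of_nonneg_right (hc k)
          (Finset.sum_nonneg fun s _ => by positivity)
    _ ≤ 1 := by
        simp_rw [one_mul]
        rw [← hu]
        exact sum_norm_sq_blockDiff_le u

/-! ### The induction along the algorithm -/

/-- **The contraction chain.**  For a `T`-query algorithm `A` (`T ≥ 1`) and weights `c` on the `2T`-subsets
with `Σ_{U ∋ k} |c_U|² ≤ 1` for every `k`: `Σ_{|R| = T} ‖Γ[ψ](R)‖² ≤ 1` for the final state `ψ`.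
(Invariant along the fold: level `≤ j`, `Σ_{|R|=2T−j} Σ_{k∈R} ‖Δ_k Γ(R)‖² ≤ 1`, and for `j ≥ 1`
`Σ_{|R|=2T−j} ‖Γ(R)‖² ≤ 1`.) [cite: EscuderoGutierrez2023, proof of Thm 1.6] -/
theorem sum_norm_sq_gam_finalState_le (A : QQueryAlg N) (hT : 1 ≤ A.queries) (c : Finset (Fin N) → ℂ)
    (hc : ∀ k : Fin N,
      ∑ U ∈ Finset.univ.filter (fun U : Finset (Fin N) => U.card = 2 * A.queries ∧ k ∈ U), ‖c U‖ ^ 2 ≤ 1) :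
    ∑ R ∈ Finset.univ.filter (fun R : Finset (Fin N) => R.card = A.queries),
      ∑ s, ‖gam c (2 * A.queries) (fun x => A.finalState x) R s‖ ^ 2 ≤ 1 := by
  let step : ((Fin N → Bool) → Fin N × Bool × A.W → ℂ) → Fin A.queries →
      ((Fin N → Bool) → Fin N × Bool × A.W → ℂ) :=
    fun Ψ j => fun b => (A.unitaries j.succ).1 *ᵥ (queryOracle b *ᵥ Ψ b)
  let init : (Fin N → Bool) → Fin N × Bool × A.W → ℂ := fun _ => (A.unitaries 0).1 *ᵥ Pi.single A.start 1
  let P : ℕ → ((Fin N → Bool) → Fin N × Bool × A.W → ℂ) → Prop := fun j Ψ =>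
    (∀ S : Finset (Fin N), j < S.card → vfc Ψ S = 0) ∧
    (∑ R ∈ Finset.univ.filter (fun R : Finset (Fin N) => R.card = 2 * A.queries - j),
        ∑ k ∈ R, ∑ s, ‖blockDiff k (gam c (2 * A.queries) Ψ R) s‖ ^ 2 ≤ 1) ∧
    (1 ≤ j → ∑ R ∈ Finset.univ.filter (fun R : Finset (Fin N) => R.card = 2 * A.queries - j),
        ∑ s, ‖gam c (2 * A.queries) Ψ R s‖ ^ 2 ≤ 1)
  have hu : ∑ s, ‖((A.unitaries 0).1 *ᵥ Pi.single A.start (1 : ℂ)) s‖ ^ 2 = 1 := by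
    rw [sum_norm_sq_mulVec_of_mem_unitaryGroup (A.unitaries 0).2, Finset.sum_eq_single A.start]
    · simp
    · intro s _ hs; simp [hs]
    · simp
  have h0 : P 0 init := by
    refine ⟨level_mulVec (level_const _) _, ?_, fun h => absurd h (by norm_num)⟩
    rw [Nat.sub_zero]
    exact base_bound c hc _ hu
  have hstep : ∀ (j : Fin A.queries) (Ψ : (Fin N → Bool) → Fin N × Bool × A.W → ℂ),
      P j Ψ → P (j + 1) (step Ψ j) := by
    rintro j Ψ ⟨hlev, hI, -⟩
    have hj := j.2
    have hm : (2 * A.queries - (j + 1)) + ((j : ℕ) + 1) = 2 * A.queries := by omega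
    have hm1 : 2 * A.queries - (j + 1) + 1 = 2 * A.queries - j := by omega
    have hJ : ∑ R ∈ Finset.univ.filter (fun R : Finset (Fin N) => R.card = 2 * A.queries - (j + 1)),
        ∑ s, ‖gam c (2 * A.queries) (step Ψ j) R s‖ ^ 2 ≤ 1 := by
      change ∑ R ∈ Finset.univ.filter (fun R : Finset (Fin N) => R.card = 2 * A.queries - (j + 1)),
        ∑ s, ‖gam c (2 * A.queries) (fun b => (A.unitaries j.succ).1 *ᵥ (queryOracle b *ᵥ Ψ b)) R s‖ ^ 2 ≤ 1
      rw [sum_norm_sq_gam_step c hlev (A.unitaries j.succ).2 hm, hm1]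
      exact hI
    refine ⟨level_mulVec (level_oracle hlev) _, ?_, fun _ => hJ⟩
    calc ∑ R ∈ Finset.univ.filter (fun R : Finset (Fin N) => R.card = 2 * A.queries - (j + 1)),
            ∑ k ∈ R, ∑ s, ‖blockDiff k (gam c (2 * A.queries) (step Ψ j) R) s‖ ^ 2
        ≤ ∑ R ∈ Finset.univ.filter (fun R : Finset (Fin N) => R.card = 2 * A.queries - (j + 1)),
            ∑ k, ∑ s, ‖blockDiff k (gam c (2 * A.queries) (step Ψ j) R) s‖ ^ 2 :=
          Finset.sum_le_sum fun R _ =>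
            Finset.sum_le_sum_of_subset_of_nonneg (Finset.subset_univ R) fun k _ _ =>
              Finset.sum_nonneg fun s _ => by positivity
      _ ≤ ∑ R ∈ Finset.univ.filter (fun R : Finset (Fin N) => R.card = 2 * A.queries - (j + 1)),
            ∑ s, ‖gam c (2 * A.queries) (step Ψ j) R s‖ ^ 2 :=
          Finset.sum_le_sum fun R _ => sum_norm_sq_blockDiff_le _
      _ ≤ 1 := hJ
  have key : P A.queries (Fin.foldl A.queries step init) := foldl_invariant A.queries step init P h0 hstep
  have e : (fun x => A.finalState x) = Fin.foldl A.queries step init :=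
    foldl_pi A.queries (fun (x : Fin N → Bool) (ψ : Fin N × Bool × A.W → ℂ) (j : Fin A.queries) =>
      (A.unitaries j.succ).1 *ᵥ (queryOracle x *ᵥ ψ)) (fun _ => (A.unitaries 0).1 *ᵥ Pi.single A.start 1)
  rw [e]
  have h := key.2.2 hT
  have hTT : 2 * A.queries - A.queries = A.queries := by omega
  rw [hTT] at h
  exact h


/-! ### The pairing with the accept-projected top vectors -/

open Classical in
/-- `Π v_R`: the vector Walsh coefficient `v_R` of the final state, projected onto the accepting basis states.
[cite: BealsEtAl2001, §2] -/
def accVfc (A : QQueryAlg N) (R : Finset (Fin N)) : Fin N × Bool × A.W → ℂ :=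
  fun s => if s ∈ A.accept then vfc (fun x => A.finalState x) R s else 0

/-- **The top-level bilinear coefficient** `B(U) = Σ_{R ⊆ U, |R| = T} ⟨Π v_R, Π v_{U∖R}⟩` of a `T`-query
algorithm at a set `U` (for `|U| = 2T` this is the Walsh coefficient `p̂(U)` of the acceptance probability —
Part 3). [cite: EscuderoGutierrez2023, §4.2] -/
def topCoeff (A : QQueryAlg N) (U : Finset (Fin N)) : ℂ :=
  ∑ R ∈ Finset.univ.filter (fun R : Finset (Fin N) => R.card = A.queries ∧ R ⊆ U),
    star (accVfc A R) ⬝ᵥ accVfc A (U \ R)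

/-- `⟨Π v_R, w⟩ = ⟨Π v_R, Π w⟩`: the projection is idempotent. [folklore] -/
theorem star_accVfc_dotProduct_vfc (A : QQueryAlg N) (R S : Finset (Fin N)) :
    star (accVfc A R) ⬝ᵥ vfc (fun x => A.finalState x) S = star (accVfc A R) ⬝ᵥ accVfc A S := by
  simp only [dotProduct, Pi.star_apply, accVfc]
  refine Finset.sum_congr rfl fun s _ => ?_
  split_ifs <;> simp

/-- **The pairing identity**: `Σ_{|R| = T} ⟨Π v_R, Γ(R)⟩ = Σ_{|U| = 2T} c_U B(U)`.
[cite: EscuderoGutierrez2023, proof of Thm 1.6] -/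
theorem pairing_eq (A : QQueryAlg N) (c : Finset (Fin N) → ℂ) :
    ∑ R ∈ Finset.univ.filter (fun R : Finset (Fin N) => R.card = A.queries),
        star (accVfc A R) ⬝ᵥ gam c (2 * A.queries) (fun x => A.finalState x) R =
      ∑ U ∈ Finset.univ.filter (fun U : Finset (Fin N) => U.card = 2 * A.queries), c U * topCoeff A U := by
  have e1 : ∀ R : Finset (Fin N), star (accVfc A R) ⬝ᵥ gam c (2 * A.queries) (fun x => A.finalState x) R =
      ∑ U ∈ Finset.univ.filter (fun U : Finset (Fin N) => U.card = 2 * A.queries ∧ R ⊆ U),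
        c U * (star (accVfc A R) ⬝ᵥ accVfc A (U \ R)) := by
    intro R
    unfold gam
    rw [dotProduct_sum]
    refine Finset.sum_congr rfl fun U _ => ?_
    rw [dotProduct_smul, smul_eq_mul, star_accVfc_dotProduct_vfc]
  simp_rw [e1]
  rw [Finset.sum_comm' (t' := Finset.univ.filter (fun U : Finset (Fin N) => U.card = 2 * A.queries))
    (s' := fun U => Finset.univ.filter (fun R : Finset (Fin N) => R.card = A.queries ∧ R ⊆ U))
    (h := fun R U => by simp only [Finset.mem_filter, Finset.mem_univ, true_and]; tauto)]
  refine Finset.sum_congr rfl fun U _ => ?_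
  rw [topCoeff, Finset.mul_sum]

/-- Cauchy–Schwarz for the complex dot product, in sum-of-squares form. [folklore] -/
theorem norm_star_dotProduct_le {ι : Type*} [Fintype ι] (u v : ι → ℂ) :
    ‖star u ⬝ᵥ v‖ ≤ Real.sqrt (∑ i, ‖u i‖ ^ 2) * Real.sqrt (∑ i, ‖v i‖ ^ 2) := by
  calc ‖star u ⬝ᵥ v‖ = ‖∑ i, star (u i) * v i‖ := rfl
    _ ≤ ∑ i, ‖star (u i) * v i‖ := norm_sum_le _ _
    _ = ∑ i, ‖u i‖ * ‖v i‖ := Finset.sum_congr rfl fun i _ => by rw [norm_mul, norm_star]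
    _ ≤ Real.sqrt (∑ i, ‖u i‖ ^ 2) * Real.sqrt (∑ i, ‖v i‖ ^ 2) :=
        Real.sum_mul_le_sqrt_mul_sqrt _ _ _

/-- The accept-projected top vectors have total squared norm at most `1` (Parseval for the unit final states).
[cite: BealsEtAl2001, §2] -/
theorem sum_norm_sq_accVfc_le (A : QQueryAlg N) :
    ∑ R ∈ Finset.univ.filter (fun R : Finset (Fin N) => R.card = A.queries), ∑ s, ‖accVfc A R s‖ ^ 2 ≤ 1 := by
  calc ∑ R ∈ Finset.univ.filter (fun R : Finset (Fin N) => R.card = A.queries), ∑ s, ‖accVfc A R s‖ ^ 2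
      ≤ ∑ R ∈ Finset.univ.filter (fun R : Finset (Fin N) => R.card = A.queries),
          ∑ s, ‖vfc (fun x => A.finalState x) R s‖ ^ 2 := by
        refine Finset.sum_le_sum fun R _ => Finset.sum_le_sum fun s _ => ?_
        unfold accVfc
        split_ifs <;> simp
    _ ≤ ∑ R, ∑ s, ‖vfc (fun x => A.finalState x) R s‖ ^ 2 :=
        Finset.sum_le_sum_of_subset_of_nonneg (Finset.filter_subset _ _) fun R _ _ =>
          Finset.sum_nonneg fun s _ => by positivity
    _ = 1 := sum_vfc_finalState_norm_sq A

/-- **The pairing bound** `|Σ_{|U| = 2T} c_U B(U)| ≤ 1` for weights with `Σ_{U ∋ k} |c_U|² ≤ 1` (all `k`).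
[cite: EscuderoGutierrez2023, Thm 1.6 (proof)] -/
theorem norm_pairing_le_one (A : QQueryAlg N) (hT : 1 ≤ A.queries) (c : Finset (Fin N) → ℂ)
    (hc : ∀ k : Fin N,
      ∑ U ∈ Finset.univ.filter (fun U : Finset (Fin N) => U.card = 2 * A.queries ∧ k ∈ U), ‖c U‖ ^ 2 ≤ 1) :
    ‖∑ U ∈ Finset.univ.filter (fun U : Finset (Fin N) => U.card = 2 * A.queries), c U * topCoeff A U‖ ≤ 1 := by
  rw [← pairing_eq]
  set F := Finset.univ.filter (fun R : Finset (Fin N) => R.card = A.queries)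
  set a : Finset (Fin N) → ℝ := fun R => ∑ s, ‖accVfc A R s‖ ^ 2
  set b : Finset (Fin N) → ℝ := fun R => ∑ s, ‖gam c (2 * A.queries) (fun x => A.finalState x) R s‖ ^ 2
  have ha : ∀ R, 0 ≤ a R := fun R => Finset.sum_nonneg fun s _ => by positivity
  have hb : ∀ R, 0 ≤ b R := fun R => Finset.sum_nonneg fun s _ => by positivity
  have hA : ∑ R ∈ F, a R ≤ 1 := sum_norm_sq_accVfc_le A
  have hB : ∑ R ∈ F, b R ≤ 1 := sum_norm_sq_gam_finalState_le A hT c hc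
  calc ‖∑ R ∈ F, star (accVfc A R) ⬝ᵥ gam c (2 * A.queries) (fun x => A.finalState x) R‖
      ≤ ∑ R ∈ F, ‖star (accVfc A R) ⬝ᵥ gam c (2 * A.queries) (fun x => A.finalState x) R‖ := norm_sum_le _ _
    _ ≤ ∑ R ∈ F, Real.sqrt (a R) * Real.sqrt (b R) :=
        Finset.sum_le_sum fun R _ => norm_star_dotProduct_le _ _
    _ ≤ Real.sqrt (∑ R ∈ F, a R) * Real.sqrt (∑ R ∈ F, b R) := Real.sum_sqrt_mul_sqrt_le F ha hb
    _ ≤ Real.sqrt 1 * Real.sqrt 1 := by gcongr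
    _ = 1 := by simp

/-- **Top-level weight versus top-level influence** (Escudero Gutiérrez, coefficient form): for every
`T`-query algorithm (`T ≥ 1`) there is an index `k` with
`(Σ_{|U| = 2T} |B(U)|²)² ≤ Σ_{|U| = 2T, U ∋ k} |B(U)|²`. [cite: EscuderoGutierrez2023, Thm 1.6 / Cor 1.7] -/
theorem exists_topWeight_sq_le (A : QQueryAlg N) (hT : 1 ≤ A.queries) :
    ∃ k : Fin N, (∑ U ∈ Finset.univ.filter (fun U : Finset (Fin N) => U.card = 2 * A.queries),
        ‖topCoeff A U‖ ^ 2) ^ 2 ≤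
      ∑ U ∈ Finset.univ.filter (fun U : Finset (Fin N) => U.card = 2 * A.queries ∧ k ∈ U), ‖topCoeff A U‖ ^ 2 := by
  have hN : (Finset.univ : Finset (Fin N)).Nonempty := ⟨A.start.1, Finset.mem_univ _⟩
  set m : Fin N → ℝ := fun k =>
    ∑ U ∈ Finset.univ.filter (fun U : Finset (Fin N) => U.card = 2 * A.queries ∧ k ∈ U), ‖topCoeff A U‖ ^ 2
  obtain ⟨k₀, -, hk₀⟩ := Finset.exists_max_image Finset.univ m hN
  refine ⟨k₀, ?_⟩
  set M := m k₀ with hMdef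
  set V := ∑ U ∈ Finset.univ.filter (fun U : Finset (Fin N) => U.card = 2 * A.queries), ‖topCoeff A U‖ ^ 2
    with hVdef
  have hm0 : ∀ k, 0 ≤ m k := fun k => Finset.sum_nonneg fun U _ => by positivity
  have hM0 : 0 ≤ M := hm0 k₀
  change V ^ 2 ≤ M
  by_cases hM : M = 0
  · -- then every top coefficient vanishes
    have hzero : ∀ U ∈ Finset.univ.filter (fun U : Finset (Fin N) => U.card = 2 * A.queries),
        ‖topCoeff A U‖ ^ 2 = 0 := by
      intro U hU
      rw [Finset.mem_filter] at hU
      have hne : U.Nonempty := by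
        rw [← Finset.card_pos, hU.2]; omega
      obtain ⟨k, hk⟩ := hne
      have hmk : m k = 0 := le_antisymm ((hk₀ k (Finset.mem_univ k)).trans hM.le) (hm0 k)
      have hle : ‖topCoeff A U‖ ^ 2 ≤ m k :=
        Finset.single_le_sum (f := fun U => ‖topCoeff A U‖ ^ 2) (fun U _ => by positivity)
          (Finset.mem_filter.mpr ⟨Finset.mem_univ U, hU.2, hk⟩)
      exact le_antisymm (hle.trans hmk.le) (by positivity)
    have hV : V = 0 := Finset.sum_eq_zero hzero
    rw [hV, hM]; norm_num
  · have hMpos : 0 < M := lt_of_le_of_ne hM0 (Ne.symm hM)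
    have hsq : 0 < Real.sqrt M := Real.sqrt_pos.mpr hMpos
    -- the extremal weights `c_U = conj B(U) / √M`
    set c : Finset (Fin N) → ℂ := fun U => star (topCoeff A U) / (Real.sqrt M : ℂ)
    have hcnorm : ∀ U, ‖c U‖ ^ 2 = ‖topCoeff A U‖ ^ 2 / M := by
      intro U
      simp only [c]
      rw [norm_div, norm_star, div_pow, Complex.norm_real, Real.norm_of_nonneg hsq.le, Real.sq_sqrt hM0]
    have hc : ∀ k : Fin N,
        ∑ U ∈ Finset.univ.filter (fun U : Finset (Fin N) => U.card = 2 * A.queries ∧ k ∈ U), ‖c U‖ ^ 2 ≤ 1 := by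
      intro k
      simp_rw [hcnorm]
      rw [← Finset.sum_div, div_le_one hMpos]
      exact hk₀ k (Finset.mem_univ k)
    have hpair := norm_pairing_le_one A hT c hc
    have hval : ∑ U ∈ Finset.univ.filter (fun U : Finset (Fin N) => U.card = 2 * A.queries), c U * topCoeff A U =
        ((V / Real.sqrt M : ℝ) : ℂ) := by
      rw [hVdef]
      push_cast
      rw [Finset.sum_div]
      refine Finset.sum_congr rfl fun U _ => ?_
      simp only [c]
      rw [div_mul_eq_mul_div, Complex.star_def, Complex.conj_mul']
    rw [hval, Complex.norm_real, Real.norm_of_nonneg (div_nonneg (Finset.sum_nonneg fun U _ => by positivity) hsq.le),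
      div_le_one hsq] at hpair
    have hV0 : 0 ≤ V := Finset.sum_nonneg fun U _ => by positivity
    calc V ^ 2 ≤ Real.sqrt M ^ 2 := pow_le_pow_left₀ hV0 hpair 2
      _ = M := Real.sq_sqrt hM0

end Summit.QuantumAdvantage.QuantumAdvantage.Theorems.SosSandwich.QueryTopLevel

end
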